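import Mathlib
import Summits.Ventures.PercRepro2.Defs
import Summits.Ventures.PercRepro2.Independence
import Summits.Ventures.PercRepro2.Graph

/-!
# Restricted configurations, closure/exit lemmas, and the component of the root in `G − A`
(blind cell PercRepro2, mine-2)

Tools for "the connection lives inside an edge set" arguments:

* `SepPair.restrictTo F ω` — the configuration `ω` with every edge outside `F` closed; an event
  stated about `restrictTo F ω` is determined by the edges of `F` (`dependsOn_restrictTo`), so
  two such events for disjoint `F₁`, `F₂` are independent (`prob_inter_eq_mul_of_dependsOn`);
* `mem_of_conn_of_closed'` — the closure lemma of `Graph.lean` in edge form;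
* the **exit lemma** `conn_restrictTo_or_exit`: if every vertex reached from `v` inside `F`
  that has an open edge leaving `F` lies in `A`, then everything connected to `v` is reached
  inside `F` or through a vertex of `A` reached inside `F`; with `A = {a₁, a₂}` and on the
  event `{a₁ ↮ a₂}` this localises the connections `v ↔ a_i` inside `F`
  (`conn_restrictTo_of_not_conn`);
* the setting of a separating pair `A = {a₁, a₂}`: `sepConfig ends A` is the configuration
  `G − A` (all edges not touching `A` open), `K = cluster ends (sepConfig ends A) o` the
  component of the root; with `F₁ = touches K`, `F₂ = F₁ᶜ`: (F1) edges of `F₁` have both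
  endpoints in `K ∪ A`, (F2) inside `F₂` nothing enters `K`, (F3) inside `F₁` nothing leaves
  `K ∪ A`; the exit hypotheses (`exit_touches`, `exit_compl`), the separation lemma
  `conn_pair_of_conn` (`o ↔ b` forces `o ↔ a₁` or `o ↔ a₂`) and the split
  `{a₁ ↮ a₂} = D₁ ∩ D₂` along `F₁`, `F₂` (`not_conn_pair_iff`).

Used by `SepPairDecomposition.lean` (Theorem M2-5: the first-hit decomposition is exact across
a separating pair).
-/

namespace Summit.Ventures.PercRepro2

namespace SepPair

/-! ## Configurations restricted to an edge set -/

section Restrict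

variable {V : Type*} {E : Type*}

/-- The configuration `ω` with every edge outside `F` closed. -/
def restrictTo (F : Set E) [DecidablePred (· ∈ F)] (ω : Config E) : Config E :=
  fun e => ω e && decide (e ∈ F)

/-- `restrictTo F ω ≤ ω`. -/
lemma restrictTo_le (F : Set E) [DecidablePred (· ∈ F)] (ω : Config E) :
    restrictTo F ω ≤ ω := fun _ => Bool.and_le_left _ _

/-- `restrictTo` on an edge of `F`. -/
lemma restrictTo_apply_of_mem {F : Set E} [DecidablePred (· ∈ F)] {ω : Config E} {e : E}
    (h : e ∈ F) : restrictTo F ω e = ω e := by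
  simp [restrictTo, h]

/-- `restrictTo` on an edge outside `F`. -/
lemma restrictTo_apply_of_notMem {F : Set E} [DecidablePred (· ∈ F)] {ω : Config E} {e : E}
    (h : e ∉ F) : restrictTo F ω e = false := by
  simp [restrictTo, h]

/-- `restrictTo F` only sees the edges of `F`. -/
lemma restrictTo_eq_of_eqOn {F : Set E} [DecidablePred (· ∈ F)] {ω ω' : Config E}
    (h : ∀ e ∈ F, ω e = ω' e) : restrictTo F ω = restrictTo F ω' := by
  funext e
  by_cases he : e ∈ F
  · rw [restrictTo_apply_of_mem he, restrictTo_apply_of_mem he, h e he]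
  · rw [restrictTo_apply_of_notMem he, restrictTo_apply_of_notMem he]

/-- An event stated about `restrictTo F ω` is determined by the edges of `F`. -/
lemma dependsOn_restrictTo (F : Set E) [DecidablePred (· ∈ F)] (A : Set (Config E)) :
    DependsOn (· ∈ restrictTo F ⁻¹' A) F := by
  intro ω ω' h
  show (restrictTo F ω ∈ A) = (restrictTo F ω' ∈ A)
  rw [restrictTo_eq_of_eqOn h]

/-- An open edge of `restrictTo F ω` lies in `F` and is open in `ω`. -/
lemma mem_and_open_of_restrictTo {F : Set E} [DecidablePred (· ∈ F)] {ω : Config E} {e : E}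
    (h : restrictTo F ω e = true) : e ∈ F ∧ ω e = true := by
  by_cases he : e ∈ F
  · exact ⟨he, by rwa [restrictTo_apply_of_mem he] at h⟩
  · rw [restrictTo_apply_of_notMem he] at h
    exact absurd h Bool.false_ne_true

/-- An edge of `F` open in `ω` is open in `restrictTo F ω`. -/
lemma restrictTo_eq_true_of_mem {F : Set E} [DecidablePred (· ∈ F)] {ω : Config E} {e : E}
    (he : e ∈ F) (h : ω e = true) : restrictTo F ω e = true := by
  rw [restrictTo_apply_of_mem he]; exact h

/-- Connection inside `F` implies connection. -/
lemma conn_of_conn_restrictTo {ends : E → Sym2 V} {F : Set E} [DecidablePred (· ∈ F)]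
    {ω : Config E} {u v : V} (h : Conn ends (restrictTo F ω) u v) : Conn ends ω u v :=
  conn_mono (restrictTo_le F ω) h

end Restrict

/-! ## Closure arguments -/

section Closure

variable {V : Type*} {E : Type*}

/-- The closure lemma in edge form: a vertex set closed along every open edge contains the
cluster of each of its members. -/
lemma mem_of_conn_of_closed' {ends : E → Sym2 V} {ω : Config E} {S : Set V}
    (hS : ∀ e x y, ω e = true → ends e = s(x, y) → x ∈ S → y ∈ S) {v u : V} (hv : v ∈ S)
    (h : Conn ends ω v u) : u ∈ S := by
  refine mem_of_conn_of_closed (ends := ends) (ω := ω) ?_ hv h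
  intro x hx y hxy
  obtain ⟨_, e, he, hends⟩ := openGraph_adj.1 hxy
  exact hS e x y he hends hx

/-- An edge whose endpoints both avoid `S` does not touch `S`. -/
lemma not_mem_touches_of_ends {ends : E → Sym2 V} {S : Set V} {e : E} {x y : V}
    (h : ends e = s(x, y)) (hx : x ∉ S) (hy : y ∉ S) : e ∉ touches ends S := by
  rintro ⟨x', hx', y', h'⟩
  rw [h, Sym2.eq_iff] at h'
  rcases h' with ⟨rfl, _⟩ | ⟨_, rfl⟩
  · exact hx hx'
  · exact hy hx'

/-- **Exit lemma.**  If every vertex reached from `v` inside `F` that has an open edge leaving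
`F` lies in `A`, then everything connected to `v` is reached inside `F`, or is reached from some
`k ∈ A` that is itself reached from `v` inside `F`. -/
lemma conn_restrictTo_or_exit {ends : E → Sym2 V} {F : Set E} [DecidablePred (· ∈ F)]
    {ω : Config E} {v : V} {A : Set V}
    (hexit : ∀ e x y, ω e = true → ends e = s(x, y) → e ∉ F →
      Conn ends (restrictTo F ω) v x → x ∈ A)
    {z : V} (hz : Conn ends ω v z) :
    Conn ends (restrictTo F ω) v z ∨
      ∃ k ∈ A, Conn ends (restrictTo F ω) v k ∧ Conn ends ω k z := by
  let S : Set V := {z | Conn ends (restrictTo F ω) v z ∨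
    ∃ k ∈ A, Conn ends (restrictTo F ω) v k ∧ Conn ends ω k z}
  have hv : v ∈ S := Or.inl (conn_refl _ _ _)
  refine mem_of_conn_of_closed' (S := S) ?_ hv hz
  intro e x y he hends hx
  rcases hx with hx | ⟨k, hk, hvk, hkx⟩
  · by_cases heF : e ∈ F
    · exact Or.inl (conn_trans hx (conn_of_openAdj ⟨e, restrictTo_eq_true_of_mem heF he, hends⟩))
    · exact Or.inr ⟨x, hexit e x y he hends heF hx, hx, conn_of_openAdj ⟨e, he, hends⟩⟩
  · exact Or.inr ⟨k, hk, hvk, conn_trans hkx (conn_of_openAdj ⟨e, he, hends⟩)⟩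

/-- On `{a₁ ↮ a₂}`, a connection from `v` to `a_i` that can only leave `F` through
`{a₁, a₂}` lives inside `F`. -/
lemma conn_restrictTo_of_not_conn {ends : E → Sym2 V} {F : Set E} [DecidablePred (· ∈ F)]
    {ω : Config E} {v a₁ a₂ : V}
    (hexit : ∀ e x y, ω e = true → ends e = s(x, y) → e ∉ F →
      Conn ends (restrictTo F ω) v x → x ∈ ({a₁, a₂} : Set V))
    (hD : ¬ Conn ends ω a₁ a₂) {i : V} (hi : i = a₁ ∨ i = a₂) (h : Conn ends ω v i) :
    Conn ends (restrictTo F ω) v i := by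
  rcases conn_restrictTo_or_exit hexit h with h' | ⟨k, hk, hvk, hki⟩
  · exact h'
  · simp only [Set.mem_insert_iff, Set.mem_singleton_iff] at hk
    rcases hk with rfl | rfl <;> rcases hi with rfl | rfl
    · exact hvk
    · exact absurd hki hD
    · exact absurd (conn_symm hki) hD
    · exact hvk

end Closure

/-! ## The separating pair: the component `K` of the root in `G − A` -/

section Setting

variable {V : Type*} {E : Type*}

open Classical in
/-- The configuration in which exactly the edges not touching `A` are open (`G − A`). -/
noncomputable def sepConfig (ends : E → Sym2 V) (A : Set V) : Config E :=
  fun e => decide (e ∉ touches ends A)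

/-- Edges open in `sepConfig` do not touch `A`. -/
lemma not_mem_touches_of_sepConfig {ends : E → Sym2 V} {A : Set V} {e : E}
    (h : sepConfig ends A e = true) : e ∉ touches ends A := by
  classical
  simpa [sepConfig] using h

/-- Edges not touching `A` are open in `sepConfig`. -/
lemma sepConfig_eq_true {ends : E → Sym2 V} {A : Set V} {e : E} (h : e ∉ touches ends A) :
    sepConfig ends A e = true := by
  classical
  simpa [sepConfig] using h

/-- The vertices of `G − A` reached from a vertex outside `A` stay outside `A`. -/
lemma not_mem_of_conn_sepConfig {ends : E → Sym2 V} {A : Set V} {o x : V} (ho : o ∉ A)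
    (h : Conn ends (sepConfig ends A) o x) : x ∉ A := by
  refine mem_of_conn_of_closed' (S := Aᶜ) ?_ ho h
  intro e x y he hends _
  exact (not_mem_of_not_mem_touches hends (not_mem_touches_of_sepConfig he)).2

/-- (F1) An edge touching the component `K = C_{G−A}(o)` has both endpoints in `K ∪ A`. -/
lemma endpoints_mem_of_mem_touches_cluster {ends : E → Sym2 V} {A : Set V} {o : V} (ho : o ∉ A)
    {e : E} (he : e ∈ touches ends (cluster ends (sepConfig ends A) o)) {x y : V}
    (hends : ends e = s(x, y)) :
    x ∈ cluster ends (sepConfig ends A) o ∪ A ∧ y ∈ cluster ends (sepConfig ends A) o ∪ A := by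
  -- one endpoint in `K` forces the other into `K ∪ A`
  have key : ∀ x y : V, ends e = s(x, y) → x ∈ cluster ends (sepConfig ends A) o →
      y ∈ cluster ends (sepConfig ends A) o ∪ A := by
    intro x y hxy hx
    by_cases hyA : y ∈ A
    · exact Or.inr hyA
    · left
      have hxA : x ∉ A := not_mem_of_conn_sepConfig ho hx
      have hopen : sepConfig ends A e = true :=
        sepConfig_eq_true (not_mem_touches_of_ends hxy hxA hyA)
      exact conn_trans hx (conn_of_openAdj ⟨e, hopen, hxy⟩)
  obtain ⟨x', hx', y', h'⟩ := he
  rw [hends, Sym2.eq_iff] at h'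
  rcases h' with ⟨rfl, rfl⟩ | ⟨rfl, rfl⟩
  · exact ⟨Or.inl hx', key _ _ hends hx'⟩
  · refine ⟨key _ _ ?_ hx', Or.inl hx'⟩
    rw [hends, Sym2.eq_swap]

/-- (F2) Inside the edges not touching `K`, nothing enters `K`. -/
lemma not_mem_of_conn_restrictTo_compl {ends : E → Sym2 V} {K : Set V}
    [DecidablePred (· ∈ (touches ends K)ᶜ)] {ω : Config E} {x y : V} (hx : x ∉ K)
    (h : Conn ends (restrictTo (touches ends K)ᶜ ω) x y) : y ∉ K := by
  refine mem_of_conn_of_closed' (S := Kᶜ) ?_ hx h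
  intro e x y he hends _
  have heF : e ∉ touches ends K := (mem_and_open_of_restrictTo he).1
  exact (not_mem_of_not_mem_touches hends heF).2

/-- (F3) Inside the edges touching `K`, nothing leaves `K ∪ A`. -/
lemma mem_union_of_conn_restrictTo_touches {ends : E → Sym2 V} {A : Set V} {o : V} (ho : o ∉ A)
    [DecidablePred (· ∈ touches ends (cluster ends (sepConfig ends A) o))] {ω : Config E}
    {x y : V} (hx : x ∈ cluster ends (sepConfig ends A) o ∪ A)
    (h : Conn ends (restrictTo (touches ends (cluster ends (sepConfig ends A) o)) ω) x y) :
    y ∈ cluster ends (sepConfig ends A) o ∪ A := by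
  refine mem_of_conn_of_closed' (S := cluster ends (sepConfig ends A) o ∪ A) ?_ hx h
  intro e x y he hends _
  exact (endpoints_mem_of_mem_touches_cluster ho (mem_and_open_of_restrictTo he).1 hends).2


/-- The exit hypothesis for `F₁ = touches K` from the root `o`: an open edge leaving `F₁` at a
vertex reached inside `F₁` starts in `A`. -/
lemma exit_touches {ends : E → Sym2 V} {A : Set V} {o : V} (ho : o ∉ A)
    [DecidablePred (· ∈ touches ends (cluster ends (sepConfig ends A) o))] (ω : Config E) :
    ∀ e x y, ω e = true → ends e = s(x, y) →
      e ∉ touches ends (cluster ends (sepConfig ends A) o) →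
      Conn ends (restrictTo (touches ends (cluster ends (sepConfig ends A) o)) ω) o x → x ∈ A := by
  intro e x y _ hends heF hx
  rcases mem_union_of_conn_restrictTo_touches ho (Or.inl (mem_cluster_self _ _ _)) hx with
    hxK | hxA
  · exact absurd (mem_touches_of_ends hends (Or.inl hxK)) heF
  · exact hxA

/-- The exit hypothesis for `F₂ = (touches K)ᶜ` from a vertex `b ∉ K`. -/
lemma exit_compl {ends : E → Sym2 V} {A : Set V} {o b : V} (ho : o ∉ A)
    (hb : b ∉ cluster ends (sepConfig ends A) o)
    [DecidablePred (· ∈ (touches ends (cluster ends (sepConfig ends A) o))ᶜ)] (ω : Config E) :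
    ∀ e x y, ω e = true → ends e = s(x, y) →
      e ∉ (touches ends (cluster ends (sepConfig ends A) o))ᶜ →
      Conn ends (restrictTo (touches ends (cluster ends (sepConfig ends A) o))ᶜ ω) b x →
        x ∈ A := by
  intro e x y _ hends heF hx
  have heF' : e ∈ touches ends (cluster ends (sepConfig ends A) o) := by simpa using heF
  have hxK : x ∉ cluster ends (sepConfig ends A) o := not_mem_of_conn_restrictTo_compl hb hx
  rcases (endpoints_mem_of_mem_touches_cluster ho heF' hends).1 with hxK' | hxA
  · exact absurd hxK' hxK
  · exact hxA

/-- **Separation**: a connection from `o` to `b` must hit `{a₁, a₂}`. -/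
lemma conn_pair_of_conn {ends : E → Sym2 V} {o a₁ a₂ b : V} (ho : o ∉ ({a₁, a₂} : Set V))
    (hb : b ∉ ({a₁, a₂} : Set V)) (hsep : ¬ Conn ends (sepConfig ends {a₁, a₂}) o b)
    {ω : Config E} (h : Conn ends ω o b) : Conn ends ω o a₁ ∨ Conn ends ω o a₂ := by
  classical
  rcases conn_restrictTo_or_exit (exit_touches ho ω) h with h' | ⟨k, hk, hok, _⟩
  · rcases mem_union_of_conn_restrictTo_touches ho (Or.inl (mem_cluster_self _ _ _)) h' with
      hbK | hbA
    · exact absurd hbK hsep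
    · exact absurd hbA hb
  · simp only [Set.mem_insert_iff, Set.mem_singleton_iff] at hk
    rcases hk with rfl | rfl
    · exact Or.inl (conn_of_conn_restrictTo hok)
    · exact Or.inr (conn_of_conn_restrictTo hok)

/-- `{a₁ ↮ a₂}` splits along `F₁ = touches K` and `F₂ = F₁ᶜ`: `D = D₁ ∩ D₂`. -/
lemma not_conn_pair_iff {ends : E → Sym2 V} {o a₁ a₂ : V} (ho : o ∉ ({a₁, a₂} : Set V))
    [DecidablePred (· ∈ touches ends (cluster ends (sepConfig ends {a₁, a₂}) o))]
    [DecidablePred (· ∈ (touches ends (cluster ends (sepConfig ends {a₁, a₂}) o))ᶜ)]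
    (ω : Config E) :
    ¬ Conn ends ω a₁ a₂ ↔
      ¬ Conn ends (restrictTo (touches ends (cluster ends (sepConfig ends {a₁, a₂}) o)) ω) a₁ a₂ ∧
      ¬ Conn ends (restrictTo (touches ends (cluster ends (sepConfig ends {a₁, a₂}) o))ᶜ ω)
        a₁ a₂ := by
  constructor
  · intro h
    exact ⟨fun h' => h (conn_of_conn_restrictTo h'), fun h' => h (conn_of_conn_restrictTo h')⟩
  · rintro ⟨h₁, h₂⟩ h
    have ha₁ : a₁ ∈ ({a₁, a₂} : Set V) := by simp
    have ha₁K : a₁ ∉ cluster ends (sepConfig ends ({a₁, a₂} : Set V)) o :=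
      fun hk => not_mem_of_conn_sepConfig ho hk ha₁
    -- the set of vertices reached from `a₁` inside `F₁` or inside `F₂`
    let S : Set V := {z |
      Conn ends (restrictTo (touches ends (cluster ends (sepConfig ends {a₁, a₂}) o)) ω) a₁ z ∨
      Conn ends (restrictTo (touches ends (cluster ends (sepConfig ends {a₁, a₂}) o))ᶜ ω) a₁ z}
    have ha₂S : a₂ ∈ S := mem_of_conn_of_closed' (S := S) ?_ (Or.inl (conn_refl _ _ _)) h
    · exact ha₂S.elim h₁ h₂
    intro e x y he hends hx
    by_cases heF : e ∈ touches ends (cluster ends (sepConfig ends ({a₁, a₂} : Set V)) o)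
    · rcases hx with hx | hx
      · exact Or.inl (conn_trans hx (conn_of_openAdj ⟨e, restrictTo_eq_true_of_mem heF he, hends⟩))
      · have hxK : x ∉ cluster ends (sepConfig ends ({a₁, a₂} : Set V)) o :=
          not_mem_of_conn_restrictTo_compl ha₁K hx
        rcases (endpoints_mem_of_mem_touches_cluster ho heF hends).1 with hxK' | hxA
        · exact absurd hxK' hxK
        · simp only [Set.mem_insert_iff, Set.mem_singleton_iff] at hxA
          rcases hxA with rfl | rfl
          · exact Or.inl (conn_of_openAdj ⟨e, restrictTo_eq_true_of_mem heF he, hends⟩)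
          · exact absurd hx h₂
    · rcases hx with hx | hx
      · have hxK : x ∉ cluster ends (sepConfig ends ({a₁, a₂} : Set V)) o :=
          fun hk => heF (mem_touches_of_ends hends (Or.inl hk))
        rcases mem_union_of_conn_restrictTo_touches ho (Or.inr ha₁) hx with hxK' | hxA
        · exact absurd hxK' hxK
        · simp only [Set.mem_insert_iff, Set.mem_singleton_iff] at hxA
          rcases hxA with rfl | rfl
          · exact Or.inr (conn_of_openAdj ⟨e, restrictTo_eq_true_of_mem heF he, hends⟩)
          · exact absurd hx h₁
      · exact Or.inr (conn_trans hx (conn_of_openAdj ⟨e, restrictTo_eq_true_of_mem heF he, hends⟩))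

end Setting

end SepPair

end Summit.Ventures.PercRepro2
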